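import Literature.Probability.LatticeModels.SRWKilledWalkFunctionals
import HarnessLib

/-!
# Monotonicity of the killed Green function in the graph

Topic `Literature/Probability/LatticeModels`; theorems only (namespace `SRW`). The Green function
`G_{Gr}(p, q) = Σ_n P[first n steps are Gr-edges, position n = q]` of the simple random walk run
along the edges of a graph `Gr` on `ℤ^d` and killed at its first non-edge step
(`SRW.killedGreen`) is MONOTONE in the graph: deleting edges (e.g. slitting the discrete domain
along a lattice path, `SimpleGraph.fromRel fun x y ↦ Gr.Adj x y ∧ x ∉ S ∧ y ∉ S`) can only kill the
walk earlier (Lawler, *Intersections of Random Walks* (1991), §1.5: `G_A ≤ G_B` for `A ⊆ B`;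
Kozdron–Lawler (2005), §2.3). Consequence: the ROOM DEFICIT `G_{Ω_δ}(z,z) - G_{Ω_δ∖γ}(z,z)` of a
point left by a polymer is nonnegative.

* `killedTrans_mono` — `Gr ≤ Gr' → P_n^{Gr}(p,q) ≤ P_n^{Gr'}(p,q)` (event inclusion);
* `killedGreen_mono` — `Gr ≤ Gr'`, `Gr'` with finitely many non-isolated vertices (so that the
  series converges, `summable_killedTrans_of_finite_support`) `→ G_{Gr} ≤ G_{Gr'}`;
* (the discretisation `Ω_δ` of a bounded domain has finitely many non-isolated vertices:
  `finite_support_discreteDomainGraph` of `SRWKilledWalkFunctionals`);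
* `killedGreen_fromRel_notMem_le` — slitting along any vertex set decreases the Green function
  (the shape `slitGraph Ω δ S ≤ slitGraph Ω δ ∅` of the room–entropy line).

No definitions, no named facts.

## References

* G. F. Lawler, *Intersections of Random Walks*, Birkhäuser (1991), §1.5.
* M. J. Kozdron, G. F. Lawler, *Estimates of random walk exit probabilities and application to
  loop-erased random walk*, Electron. J. Probab. 10 (2005), §2.3.
-/

noncomputable section

open MeasureTheory Set
open scoped Classical

namespace Literature.Probability.LatticeModels

namespace SRW

variable {d : ℕ}

/-- **The killed transition function is monotone in the graph**: a walk whose first `n` steps are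
`Gr`-edges has `Gr'`-edges as first `n` steps for every `Gr ≤ Gr'`. [cite: KozdronLawler2005, §2.3] -/
theorem killedTrans_mono [NeZero d] {Gr Gr' : SimpleGraph (Site d)} (h : Gr ≤ Gr') (n : ℕ)
    (p q : Site d) : killedTrans Gr n p q ≤ killedTrans Gr' n p q := by
  unfold killedTrans
  refine measureReal_mono (fun ω hω ↦ ?_) (measure_ne_top _ _)
  exact ⟨fun j hj ↦ h (hω.1 j hj), hω.2⟩

/-- **The killed Green function is monotone in the graph** (`Gr ≤ Gr'`, `Gr'` with finitely many
non-isolated vertices): `G_{Gr}(p,q) ≤ G_{Gr'}(p,q)`. [cite: KozdronLawler2005, §2.3] -/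
theorem killedGreen_mono [NeZero d] {Gr Gr' : SimpleGraph (Site d)} (h : Gr ≤ Gr')
    (hfin : Gr'.support.Finite) (p q : Site d) : killedGreen Gr p q ≤ killedGreen Gr' p q := by
  have hfin' : Gr.support.Finite := hfin.subset fun x ⟨y, hxy⟩ ↦ ⟨y, h hxy⟩
  unfold killedGreen
  exact (summable_killedTrans_of_finite_support hfin' p q).tsum_le_tsum
    (fun n ↦ killedTrans_mono h n p q) (summable_killedTrans_of_finite_support hfin p q)

/-- **Slitting decreases the room**: for a graph `Gr` with finitely many non-isolated vertices and
any vertex set `S`, the Green function of `Gr` with the vertices of `S` isolated is at most that of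
`Gr` (with `∅` isolated, i.e. `Gr` itself in the same `fromRel` shape). This is the nonnegativity
of the room deficit `G_{Ω_δ}(z,z) - G_{Ω_δ∖S}(z,z)`. [cite: KozdronLawler2005, §2.3] -/
theorem killedGreen_fromRel_notMem_le [NeZero d] {Gr : SimpleGraph (Site d)}
    (hfin : Gr.support.Finite) (S : Set (Site d)) (p q : Site d) :
    killedGreen (SimpleGraph.fromRel fun x y ↦ Gr.Adj x y ∧ x ∉ S ∧ y ∉ S) p q ≤
      killedGreen (SimpleGraph.fromRel fun x y ↦ Gr.Adj x y ∧ x ∉ (∅ : Set (Site d)) ∧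
        y ∉ (∅ : Set (Site d))) p q := by
  have hle : (SimpleGraph.fromRel fun x y ↦ Gr.Adj x y ∧ x ∉ S ∧ y ∉ S) ≤
      SimpleGraph.fromRel fun x y ↦ Gr.Adj x y ∧ x ∉ (∅ : Set (Site d)) ∧ y ∉ (∅ : Set (Site d)) := by
    intro x y hxy
    rw [fromRel_adj_and_notMem_iff] at hxy ⊢
    exact ⟨hxy.1, notMem_empty _, notMem_empty _⟩
  have hfin' : (SimpleGraph.fromRel fun x y ↦ Gr.Adj x y ∧ x ∉ (∅ : Set (Site d)) ∧
      y ∉ (∅ : Set (Site d))).support.Finite :=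
    hfin.subset fun x ⟨y, hxy⟩ ↦ ⟨y, fromRel_and_notMem_le Gr ∅ hxy⟩
  exact killedGreen_mono hle hfin' p q

end SRW

end Literature.Probability.LatticeModels

end
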